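import Summits.HodgeConjecture.HodgeConjecture.Theorems.Ring2AbelianAllAndreSmoothFamilyKernelOfDeligne
import Literature.AlgebraicGeometry.HodgeTheory.InvariantClassesFromTotalSpaceHolds
import HarnessLib

/-!
# Ring 2 · sub-cell AbelianAll (ALL ABELIAN VARIETIES), André axis, part XII-e — the supply node (κ) is
# an UNCONDITIONAL THEOREM; the named fact `Deligne1971_fibreGysin_injOn_restricted` is DISCHARGED; every
# `K[κ]` / `K[h418]` row of the Lefschetz column loses that hypothesis

HONEST FRAMING (page 1, verbatim): **research route, not a corollary; conditional on HC_CM plus one named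
minimal statement.** Cell line: research route conditional on HC_CM; not a corollary; Q11.4-sentence-2
already refuted in dim ≥ 3. Nothing in this file proves a case of the Hodge conjecture for an abelian variety.
Seat `pub-hodge-ring2-ab-andre-2`, gen 4; referee findings **F-ab-39** (κ is an unconditional tree theorem:
parts XII-b/XII-d took `h418 = deligne1968_invariantClass_fromTotalSpace` as a hypothesis, and the tree PROVES
that fact — `deligne1968_invariantClass_fromTotalSpace_holds`, `HodgeTheory/InvariantClassesFromTotalSpaceHolds`
(Voisin II §4.2.3–4.3.1 formalised: Ehresmann ⟹ Serre fibration, relative hard Lefschetz, Deligne's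
degeneration; 0 sorry, standard axioms)) and **F-ab-40** (discharge the assembled fact κ̂ rather than cite it).

## Content — one-line compositions, no new mathematics

* `deligne1971_fibreGysin_injOn_restricted_holds : Deligne1971_fibreGysin_injOn_restricted` — **the lit
  seat's named fact "`Ker j_{t*} ∩ Im j_t^* = 0` for every smooth projective family over a smooth projective base"
  is a THEOREM** (part XII-d ∘ `…_holds`); `restrict_eq_zero_of_complexGysin_eq_zero` (every fibre).
* **`fibreGysinKernelOn_holds (hf) : FibreGysinKernelOn hf`, `fibreGysinKernelCompactPencils_holds :
  FibreGysinKernelCompactPencils`** — (κ_f), (κ) hold outright.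
* `fibreClassLefschetzOn_iff_quasiInverse : (β′_f) ↔ (A_f)`, `fibreClassLefschetzPointwiseOn_iff_of_codim :
  HC^{d}(𝒳×𝒳) ⊢ (β′ᵖᵗ_f)` … — the EXACT content of the Lefschetz-type node is now its algebraic half alone.
* κ-free rows: `fibreClassLefschetzPointwiseOn_of_codim'`, `fibreClassLefschetzOn_of_codim'`,
  `fibreClassLefschetzOnAtRelDim_of_codim'`, `fibreClassLefschetzPointwiseCompactPencils_of_hodgeConjecture'`
  (**`HodgeConjecture → (β∀′ᵖᵗ)` with NO supply node**), `…CMPointedPencils…'`,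
  `fibreClassLefschetzOnCompactPencils_of_hodgeConjecture'` (K[φ]), `…OnCMPointedPencils…'`, `…AtRelDim…'`,
  `cmAnchoredPencilFibreClassLefschetzOn_of_hodgeConjecture'` (K[φ, h₂₁]), `lefschetzLadder_of_hodgeConjecture'`,
  the Weil rows `weilSixfolds_of_cmPowerWeilPencilsAt_of_codimSix'`, `nonsplitSixfolds_…'`,
  `weilClassesImaginaryQuadratic_of_cmPowerWeilPencils_of_codim'` (K[(W_E), φ, HC^{codim}], no `HC_CM`).

What remains a hypothesis on the Lefschetz column after this part: (φ) fibre-class constancy (lit's named fact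
φ̂ `Fulton1998_map_fundamentalClass_fibre_eq` supplies it), André's Lemme 6.3.1 `h₂₁` where a CM-anchored pencil
is needed, the habitats (W_E)ₙ, and the Hodge conjecture for ONE codimension of the squares `𝒳 × 𝒳` — the
cycle-theoretic content. NOT a case of HC; `HC_CM` absent throughout.

References: VoisinHodgeII2003 (Thm. 4.15, 4.18); Deligne1968 ((2.1), (2.6.3)); DeligneHodgeII1971 (4.1.1, 4.2.6);
Decataldo2007 (Ex. 8.5.2–8.5.3, Prop. 8.5.5); Abdulali1994FamiliesAV (Conj. 5.3, Thm. 5.5); Andre1996Motifs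
(Lemme 6.3.1, Remarque 2); Weil1977HodgeRing.
-/

noncomputable section

set_option linter.dupNamespace false

namespace Summit.HodgeConjecture.HodgeConjecture.Ring2.AbelianAll

open CategoryTheory AlgebraicGeometry MonoidalCategory
open Literature.AlgebraicGeometry Literature.AlgebraicGeometry.Motives
open Literature.AlgebraicGeometry.HodgeTheory
open Literature.AlgebraicGeometry.Andre1996 (andre1996_cmAnchoredPencil)
open Summit.HodgeConjecture.HodgeConjecture
open Summit.HodgeConjecture.HodgeConjecture.Theses
open Summit.HodgeConjecture.HodgeConjecture.WeilTypeLadder (WeilClassesImaginaryQuadratic NonsplitSixfolds)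

variable {𝒳 S : SchemeOver ℂ}

/-! ## §1 The named fact κ̂ and the supply node κ are theorems -/

/-- **DISCHARGE of the named fact `Deligne1971_fibreGysin_injOn_restricted`** ("`Ker j_{t*} ∩ Im j_t^* = 0`" for
every smooth projective family over a smooth projective base with smooth projective total space, all degrees):
part XII-d's derivation from Voisin II Thm. 4.18, composed with the tree's proof of that theorem
(`deligne1968_invariantClass_fromTotalSpace_holds`). [cite: VoisinHodgeII2003, §4.2.3 Thm. 4.15 and §4.3.1 Thm. 4.18]
[cite: DeligneHodgeII1971, Thm. 4.1.1 and Thm. 4.2.6] [cite: Decataldo2007, Ex. 8.5.2–8.5.3 and Prop. 8.5.5] -/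
theorem deligne1971_fibreGysin_injOn_restricted_holds : Deligne1971_fibreGysin_injOn_restricted :=
  deligne1971_fibreGysin_injOn_restricted_of_deligne1968 deligne1968_invariantClass_fromTotalSpace_holds

/-- Every fibre, unconditionally: `j_{t*}(j_t^* W) = 0` at one point forces `j_s^* W = 0` at every point of the
base (general smooth projective family over a smooth projective base). [cite: VoisinHodgeII2003, §4.3.1 Thm. 4.18]
[cite: Andre1996Motifs, §5.1 (p. 25)] -/
theorem restrict_eq_zero_of_complexGysin_eq_zero {n m N : ℕ} {f : 𝒳 ⟶ S} (hS : IsSmoothProjective m S)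
    (hf : IsSmoothProjectiveFamily f n) (h𝒳 : IsSmoothProjective N 𝒳) {k b : ℕ} (hkb : k + 2 * N = b + 2 * n)
    (t s : ComplexPoints S) (W : complexBetti 𝒳 k)
    (hW : complexGysin complexOrientationFamily (hf.isSmoothProjective t) h𝒳 (fiberι f t) hkb
      (complexBetti.map (fiberι f t) k W) = 0) :
    complexBetti.map (fiberι f s) k W = 0 :=
  restrict_eq_zero_of_complexGysin_eq_zero_of_deligne1968 deligne1968_invariantClass_fromTotalSpace_holds
    hS hf h𝒳 hkb t s W hW

/-- **(κ_f) holds for every compact pencil of abelian varieties** — Deligne's invariant-cycle kernel identity, the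
supply node of parts X-b/X-c, is a THEOREM. [cite: DeligneHodgeII1971, Thm. 4.1.1 and Thm. 4.2.6]
[cite: VoisinHodgeII2003, §4.3.1 Thm. 4.18] -/
theorem fibreGysinKernelOn_holds {d : ℕ} {f : 𝒳 ⟶ S} (hf : IsCompactAbelianPencil f d) : FibreGysinKernelOn hf :=
  fibreGysinKernelOn_of_deligne1968 deligne1968_invariantClass_fromTotalSpace_holds hf

/-- **(κ) `FibreGysinKernelCompactPencils` holds** (no hypothesis). [cite: DeligneHodgeII1971, Thm. 4.1.1 and Thm. 4.2.6]
[cite: VoisinHodgeII2003, §4.3.1 Thm. 4.18] -/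
theorem fibreGysinKernelCompactPencils_holds : FibreGysinKernelCompactPencils :=
  fibreGysinKernelCompactPencils_of_deligne1968 deligne1968_invariantClass_fromTotalSpace_holds

/-! ## §2 The Lefschetz-type node is its algebraic half -/

/-- **`(β′_f) ⟺ (A_f)`**: with κ a theorem, part VIII's fibre-class Lefschetz node on one pencil IS "cup with the
fibre class has an ALGEBRAIC quasi-inverse" (part X-b's split `(β′_f) ⟺ κ_f ∧ A_f`).
[cite: Abdulali1994FamiliesAV, Conjecture 5.3 and Theorem 5.5 (p. 1130)] -/
theorem fibreClassLefschetzOn_iff_quasiInverse {d : ℕ} {f : 𝒳 ⟶ S} (hf : IsCompactAbelianPencil f d) :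
    FibreClassLefschetzOn hf ↔ AlgebraicFibreClassQuasiInverseOn hf :=
  (fibreClassLefschetzOn_iff_kernel_and_quasiInverse hf).trans
    ⟨fun h ↦ h.2, fun h ↦ ⟨fibreGysinKernelOn_holds hf, h⟩⟩

/-- `(β′ᵖᵗ_f)` from the codimension-`d` Hodge classes of `𝒳 × 𝒳` ALONE (part X-d's row, κ discharged).
[cite: Abdulali1994FamiliesAV, Conjecture 5.3 and Remark 5.4 (p. 1130)] [cite: VoisinHodgeI2002, §11.3.3 Lemma 11.41] -/
theorem fibreClassLefschetzPointwiseOn_of_codim' {d : ℕ} {f : 𝒳 ⟶ S} (hf : IsCompactAbelianPencil f d)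
    (halg : ∀ c : complexBetti (𝒳 ⊗ 𝒳) (2 * d), IsRationalClass c →
      IsOfHodgeType ((d + 1) + (d + 1)) (𝒳 ⊗ 𝒳) (2 * d) d d c → c ∈ algebraicClasses (𝒳 ⊗ 𝒳) d) :
    FibreClassLefschetzPointwiseOn hf :=
  fibreClassLefschetzPointwiseOn_of_codim hf (fibreGysinKernelOn_holds hf) halg

/-- `(β′ᵖᵗ_f)` from `HC(𝒳 × 𝒳)` alone (part X-c's row, κ discharged). [cite: Voisin2025, Prop. 2.11 and §3.2.2] -/
theorem fibreClassLefschetzPointwiseOn_of_hodgeConjectureFor' {d : ℕ} {f : 𝒳 ⟶ S} (hf : IsCompactAbelianPencil f d)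
    (hHC : HodgeConjectureFor ((d + 1) + (d + 1)) (𝒳 ⊗ 𝒳)) : FibreClassLefschetzPointwiseOn hf :=
  fibreClassLefschetzPointwiseOn_of_hodgeConjectureFor hf (fibreGysinKernelOn_holds hf) hHC

/-- `(β′_f)` from fibre-class constancy and the codimension-`d` Hodge classes of the square (κ discharged).
[cite: Abdulali1994FamiliesAV, Conjecture 5.3 and Remark 5.4 (p. 1130)] -/
theorem fibreClassLefschetzOn_of_codim' {d : ℕ} {f : 𝒳 ⟶ S} (hf : IsCompactAbelianPencil f d)
    (hφ : FibreClassConstantOn hf)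
    (halg : ∀ c : complexBetti (𝒳 ⊗ 𝒳) (2 * d), IsRationalClass c →
      IsOfHodgeType ((d + 1) + (d + 1)) (𝒳 ⊗ 𝒳) (2 * d) d d c → c ∈ algebraicClasses (𝒳 ⊗ 𝒳) d) :
    FibreClassLefschetzOn hf :=
  fibreClassLefschetzOn_of_codim hf (fibreGysinKernelOn_holds hf) hφ halg

/-- The graded node `(β′)_d` modulo φ and codimension-`d` Hodge classes on the squares (κ discharged).
[cite: Abdulali1994FamiliesAV, Conjecture 5.3 (p. 1130)] -/
theorem fibreClassLefschetzOnAtRelDim_of_codim' (d : ℕ) (hφ : FibreClassConstantCompactPencils)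
    (halg : ∀ ⦃𝒳 S : SchemeOver ℂ⦄ ⦃f : 𝒳 ⟶ S⦄, IsCompactAbelianPencil f d →
      ∀ c : complexBetti (𝒳 ⊗ 𝒳) (2 * d), IsRationalClass c →
        IsOfHodgeType ((d + 1) + (d + 1)) (𝒳 ⊗ 𝒳) (2 * d) d d c → c ∈ algebraicClasses (𝒳 ⊗ 𝒳) d) :
    FibreClassLefschetzOnAtRelDim d :=
  fibreClassLefschetzOnAtRelDim_of_codim d fibreGysinKernelCompactPencils_holds hφ halg

/-! ## §3 On-path rows: `HodgeConjecture ⟹ (β∀′ᵖᵗ)` with NO supply node; (β∀′) modulo φ only -/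

/-- **`HodgeConjecture → (β∀′ᵖᵗ)` — the pointwise fibre-class Lefschetz node on every compact pencil of abelian
varieties is a CASE OF THE SUMMIT, with no supply node and no named fact** (part X-c's row, κ discharged).
[cite: Andre1996Motifs, §6.3 Remarque 2 (p. 33)] [cite: VoisinHodgeII2003, §4.3.1 Thm. 4.18] -/
theorem fibreClassLefschetzPointwiseCompactPencils_of_hodgeConjecture' (h : _root_.HodgeConjecture) :
    FibreClassLefschetzPointwiseCompactPencils :=
  fibreClassLefschetzPointwiseCompactPencils_of_hodgeConjecture fibreGysinKernelCompactPencils_holds h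

/-- `HodgeConjecture → (β′ᵖᵗ)` (CM-pointed pencils). [cite: Andre1996Motifs, §6.3 Remarque 2 (p. 33)] -/
theorem fibreClassLefschetzPointwiseCMPointedPencils_of_hodgeConjecture' (h : _root_.HodgeConjecture) :
    FibreClassLefschetzPointwiseCMPointedPencils :=
  fibreClassLefschetzPointwiseCMPointedPencils_of_compactPencils
    (fibreClassLefschetzPointwiseCompactPencils_of_hodgeConjecture' h)

/-- Under the Hodge conjecture the pointwise node and κ both hold — part X-c's `HC ⊢ (β∀′ᵖᵗ) ⟺ κ` with both sides
now theorems under `HC`. [cite: Andre1996Motifs, §6.3 Remarque 2 (p. 33)] -/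
theorem kernel_and_pointwise_of_hodgeConjecture (h : _root_.HodgeConjecture) :
    FibreGysinKernelCompactPencils ∧ FibreClassLefschetzPointwiseCompactPencils :=
  ⟨fibreGysinKernelCompactPencils_holds, fibreClassLefschetzPointwiseCompactPencils_of_hodgeConjecture' h⟩

/-- **`HodgeConjecture → (β∀′)` modulo fibre-class constancy (φ) ONLY** (part X-b's row, κ discharged).
[cite: Andre1996Motifs, §6.3 Remarque 2 (p. 33)] -/
theorem fibreClassLefschetzOnCompactPencils_of_hodgeConjecture' (hφ : FibreClassConstantCompactPencils)
    (h : _root_.HodgeConjecture) : FibreClassLefschetzOnCompactPencils :=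
  fibreClassLefschetzOnCompactPencils_of_hodgeConjecture fibreGysinKernelCompactPencils_holds hφ h

/-- `HodgeConjecture → (β′)` modulo φ. [cite: Andre1996Motifs, §6.3 Remarque 2 (p. 33)] -/
theorem fibreClassLefschetzOnCMPointedPencils_of_hodgeConjecture' (hφ : FibreClassConstantCompactPencils)
    (h : _root_.HodgeConjecture) : FibreClassLefschetzOnCMPointedPencils :=
  fibreClassLefschetzOnCMPointedPencils_of_hodgeConjecture fibreGysinKernelCompactPencils_holds hφ h

/-- `HodgeConjecture → (β′)_d` modulo φ, every `d`. [cite: Andre1996Motifs, §6.3 Remarque 2 (p. 33)] -/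
theorem fibreClassLefschetzOnAtRelDim_of_hodgeConjecture' (hφ : FibreClassConstantCompactPencils)
    (h : _root_.HodgeConjecture) (d : ℕ) : FibreClassLefschetzOnAtRelDim d :=
  fibreClassLefschetzOnAtRelDim_of_hodgeConjecture fibreGysinKernelCompactPencils_holds hφ h d

/-- `HodgeConjecture → (β∃′)` modulo φ and Lemme 6.3.1 (which supplies the CM-anchored pencil).
[cite: Andre1996Motifs, Lemme 6.3.1 (p. 31) and Remarque 2 (p. 33)] -/
theorem cmAnchoredPencilFibreClassLefschetzOn_of_hodgeConjecture' (h₂₁ : andre1996_cmAnchoredPencil)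
    (hφ : FibreClassConstantCompactPencils) (h : _root_.HodgeConjecture) : CMAnchoredPencilFibreClassLefschetzOn :=
  cmAnchoredPencilFibreClassLefschetzOn_of_hodgeConjecture h₂₁ fibreGysinKernelCompactPencils_holds hφ h

/-- **The André ladder through the Lefschetz-type node from `HodgeConjecture` ALONE**: (β∀′ᵖᵗ), (L∀), (2), (L), (3),
(4). [cite: Andre1996Motifs, §6.3 Remarque 2 (p. 33)] -/
theorem lefschetzLadder_of_hodgeConjecture' (h : _root_.HodgeConjecture) :
    FibreClassLefschetzPointwiseCompactPencils ∧ AlgebraicFixedPart ∧ Deform.CompactAbelianPencilVHC ∧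
      CMFibreAlgebraicLift ∧ CMPointedPencilVHC ∧ CMAnchoredTransport :=
  lefschetzLadder_of_hodgeConjecture_of_kernel fibreGysinKernelCompactPencils_holds h

/-! ## §4 The Weil rows without κ (and without `HC_CM`) -/

/-- **`(W_E)₃ ∧ φ ∧ HC^6(the 14-fold squares of the rel-dim-6 compact abelian pencils) ⟹ WeilSixfolds`** (item
stmt-HodgeConjecture-2524 as a target; part X-e's row, κ discharged; no `HC_CM`, no named fact).
research route, not a corollary; conditional on HC_CM plus one named minimal statement.
[cite: Andre1996Motifs, §6.3 Remarque 2 (p. 33)] [cite: Weil1977HodgeRing] -/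
theorem weilSixfolds_of_cmPowerWeilPencilsAt_of_codimSix' (hW : CMPowerAnchoredCompactWeilPencilsAt 3)
    (hφ : FibreClassConstantCompactPencils)
    (halg : ∀ ⦃𝒳 S : SchemeOver ℂ⦄ ⦃f : 𝒳 ⟶ S⦄, IsCompactAbelianPencil f 6 →
      ∀ c : complexBetti (𝒳 ⊗ 𝒳) (2 * 6), IsRationalClass c →
        IsOfHodgeType ((6 + 1) + (6 + 1)) (𝒳 ⊗ 𝒳) (2 * 6) 6 6 c → c ∈ algebraicClasses (𝒳 ⊗ 𝒳) 6) :
    Theses.SevenfoldWeilCensus.WeilSixfolds :=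
  weilSixfolds_of_cmPowerWeilPencilsAt_of_kernel_of_codimSix hW fibreGysinKernelCompactPencils_holds hφ halg

/-- The same for the NON-SPLIT sixfolds (hweil's rung R1′), κ discharged. [cite: Andre1996Motifs, §6.3 Remarque 2 (p. 33)] -/
theorem nonsplitSixfolds_of_cmPowerWeilPencilsAt_of_codimSix' (hW : CMPowerAnchoredCompactWeilPencilsAt 3)
    (hφ : FibreClassConstantCompactPencils)
    (halg : ∀ ⦃𝒳 S : SchemeOver ℂ⦄ ⦃f : 𝒳 ⟶ S⦄, IsCompactAbelianPencil f 6 →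
      ∀ c : complexBetti (𝒳 ⊗ 𝒳) (2 * 6), IsRationalClass c →
        IsOfHodgeType ((6 + 1) + (6 + 1)) (𝒳 ⊗ 𝒳) (2 * 6) 6 6 c → c ∈ algebraicClasses (𝒳 ⊗ 𝒳) 6) :
    NonsplitSixfolds :=
  nonsplitSixfolds_of_cmPowerWeilPencilsAt_of_kernel_of_codimSix hW fibreGysinKernelCompactPencils_holds hφ halg

/-- **Weil's question (R∞), all `n ≥ 2`**, κ discharged: `(∀ n ≥ 2, (W_E)ₙ) ∧ φ ∧ (∀ n ≥ 2, HC^{2n} of the squares)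
⟹ WeilClassesImaginaryQuadratic`; no `HC_CM`, no named fact. [cite: Weil1977HodgeRing]
[cite: Abdulali1994FamiliesAV, Conjecture 5.3 (p. 1130)] -/
theorem weilClassesImaginaryQuadratic_of_cmPowerWeilPencils_of_codim'
    (hW : ∀ n, 2 ≤ n → CMPowerAnchoredCompactWeilPencilsAt n) (hφ : FibreClassConstantCompactPencils)
    (halg : ∀ n, 2 ≤ n → ∀ ⦃𝒳 S : SchemeOver ℂ⦄ ⦃f : 𝒳 ⟶ S⦄, IsCompactAbelianPencil f (2 * n) →
      ∀ c : complexBetti (𝒳 ⊗ 𝒳) (2 * (2 * n)), IsRationalClass c →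
        IsOfHodgeType ((2 * n + 1) + (2 * n + 1)) (𝒳 ⊗ 𝒳) (2 * (2 * n)) (2 * n) (2 * n) c →
          c ∈ algebraicClasses (𝒳 ⊗ 𝒳) (2 * n)) :
    WeilClassesImaginaryQuadratic :=
  weilClassesImaginaryQuadratic_of_cmPowerWeilPencils_of_kernel_of_codim hW fibreGysinKernelCompactPencils_holds
    hφ halg

end Summit.HodgeConjecture.HodgeConjecture.Ring2.AbelianAll

end
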